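import Mathlib
import HarnessLib
import Summits.NavierStokesRegularity.NavierStokesRegularity.Theorems.LocalHelicityTubeDoorFrobeniusProfileRigidityGermQuadrichotomy
import Summits.NavierStokesRegularity.NavierStokesRegularity.Theorems.LocalHelicityTubeDoorFrobeniusProfileRigidityHelicalSlice
import Summits.NavierStokesRegularity.NavierStokesRegularity.Theorems.PoloidalWindowDoorPoloidalWindowRigidityVorticityTranslate
import Summits.NavierStokesRegularity.NavierStokesRegularity.Theorems.PoloidalWindowDoorPoloidalWindowRigidityVorticityTimePeriodic
import Summits.NavierStokesRegularity.NavierStokesRegularity.Theorems.PoloidalWindowDoorPoloidalWindowRigidityZoomOut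
import Summits.NavierStokesRegularity.NavierStokesRegularity.Theorems.PoloidalWindowDoorPoloidalWindowRigiditySimilarity

/-!
# Door S11 `LocalTubeDoorHelicity`, profile crux K2⁗ `FrobeniusProfileRigidity` — the SHARPEST RESIDUE of record:
# every settled bare-class stratum in the tree, germ forms included, as ONE entry point for a K2⁗ prover

Cell ns-regularity-ideate, seat p6 (route-directed support for the door route `route-helicity`; lands `--supports` the
K2⁗ item; no claim on the crux).  Supersedes `…FrobeniusProfileRigiditySharper.frobeniusProfileRigidity_of_sharper`
(6 strata) as the MENU of what a residue prover of K2⁗ may assume for free: `frobeniusProfileRigidity_of_sharpest`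
reduces K2⁗ (profile form, verbatim the `hprofile` binder of `localTubeDoorHelicity_of_profileRigidity`) to the
helicity-free profiles of the Type-I class for which NONE of the following 19 strata occurs — each stated as the
NEGATED EXISTENTIAL of the stratum, each excluded alternative being a TREE THEOREM (cited in the proof, one line each):
  (1) aligned slice (R7);
  (2) translation-invariant slice;
  (3) axisymmetric without swirl about some axis, one slice;
  (4) backward self-similar about some centre;
  (5) time-periodic;
  (6) one velocity component identically zero (S10's strict shadow);
  (7) GERM: vorticity aligned on a window of one slice;
  (8) GERM: one directional derivative vanishing on a window of one slice (S13's one-slice crux);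
  (9) GERM: infinitesimally axisymmetric and swirl-free in some rigid frame on a window of one slice;
  (10) GERM: AFFINE vorticity on a window of one slice (screw fields included);
  (11) spatially periodic slice;
  (12) helically symmetric slice about some axis, pitch ≠ 0 (swirl allowed);
  (13) (−1)-homogeneous slice about some centre;
  (14) slice equivariant under a finite-order rigid screw (rational discrete screw, glide);
  (15) VORTICITY translation-invariant along a line on one slice (stratum (A));
  (16) HARMONIC vorticity on one slice (stratum (B));
  (17) time-periodic VORTICITY;
  (18) relative periodic modulo a rigid motion;
  (19) scale-invariant size tending to zero in the far past (zoom-out, M9);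
sources: p6 lineage (Strata/Sharper/GermQuadrichotomy), nsreg-p5 g7 (ScrewSlice/HelicalSlice), ns-poloidal-K2-p3
(VorticityTranslate/VorticityTimePeriodic), ns-poloidal-K2-p2 (ZoomOut/Similarity), S13 (`oneSliceCrux_dirDerivNorm`),
S10 (`not_backwardSingular_of_inner_eq_zero`).  Not listed (need poloidality, hence not available in the Frobenius
class): axisymmetric VORTICITY about an axis, similar tilted slices.  The EXTREMAL normal form
(`…FrobeniusProfileRigidityExtremal.exists_frobenius_extremal`) is orthogonal to this list and may be combined with it by
a lead (it replaces the profile, so it is not a hypothesis on the same `v`).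

CAUTION (as in the germ file): what remains is a GLOBAL-TO-GERM problem for profiles of the class; the in-class-minus-(M)
and the jet-level versions are false (refuter1 `…/Negative/OffFourStrata.lean`, `…/GermOffFourStrata.lean`; Šverák 2011
§4; LIT-PACK §R47/§R52).

SUPPORT EDGE (route-NavierStokesRegularity-LocalHelicityTubeDoor born; director-ns g6 #1 (5)): this file is re-pointed
`--supports stmt-NavierStokesRegularity-19975 --as helper` (nsreg-p6 g6 p478367: sharpest residue (19 strata) ⇒ K2⁗); it was parked on the
CLOSED fallback anchor stmt-NavierStokesRegularity-20018 while the route was unborn.  Declarations unchanged.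

WHAT THIS IS NOT: not a claim about Navier–Stokes regularity and not K2⁗ — a bookkeeping reduction collecting settled
strata (bears_on LADDER-NS N0, door S11).
-/

noncomputable section

-- the summit and its single sub-problem share the name (CONVENTIONS §1), as in every Theorems file
set_option linter.dupNamespace false

namespace Summit.NavierStokesRegularity.NavierStokesRegularity.Theorems.LocalHelicityTubeDoorFrobeniusProfileRigiditySharpest

open MeasureTheory Set Function Filter Topology TopologicalSpace Metric
open scoped RealInnerProductSpace InnerProductSpace Laplacian
open Literature.Analysis Literature.Analysis.FluidPDE
open Summit.NavierStokesRegularity.NavierStokesRegularity.Theorems.LocalSineTubeDoorProfileAlignedWindowRigidityAncient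
open Summit.NavierStokesRegularity.NavierStokesRegularity.Theorems.LocalSineTubeDoorProfileAlignedWindowRigidity
open Summit.NavierStokesRegularity.NavierStokesRegularity.Theorems.PoloidalWindowDoorPoloidalWindowRigidityFlat
open Summit.NavierStokesRegularity.NavierStokesRegularity.Theorems.PoloidalWindowDoorPoloidalWindowRigidityStrata
open Summit.NavierStokesRegularity.NavierStokesRegularity.Theorems.PoloidalWindowDoorPoloidalWindowRigidityOneSlice
open Summit.NavierStokesRegularity.NavierStokesRegularity.Theorems.PoloidalWindowDoorPoloidalWindowRigidityVorticityTranslate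
open Summit.NavierStokesRegularity.NavierStokesRegularity.Theorems.PoloidalWindowDoorPoloidalWindowRigidityVorticityTimePeriodic
open Summit.NavierStokesRegularity.NavierStokesRegularity.Theorems.PoloidalWindowDoorPoloidalWindowRigidityZoomOut
open Summit.NavierStokesRegularity.NavierStokesRegularity.Theorems.PoloidalWindowDoorPoloidalWindowRigiditySimilarity
open Summit.NavierStokesRegularity.NavierStokesRegularity.Theorems.LocalHelicityTubeDoorFrobeniusProfileRigidityStrata
open Summit.NavierStokesRegularity.NavierStokesRegularity.Theorems.LocalHelicityTubeDoorFrobeniusProfileRigiditySharper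
open Summit.NavierStokesRegularity.NavierStokesRegularity.Theorems.LocalHelicityTubeDoorFrobeniusProfileRigidityScrewSlice
open Summit.NavierStokesRegularity.NavierStokesRegularity.Theorems.LocalHelicityTubeDoorFrobeniusProfileRigidityHelicalSlice
open Summit.NavierStokesRegularity.NavierStokesRegularity.Theorems.LocalHelicityTubeDoorFrobeniusProfileRigidityGermQuadrichotomy
open Summit.NavierStokesRegularity.NavierStokesRegularity.Theorems.LocalSineTubeDoorOneDirectionDoor

/-- **K2⁗ (profile form) ⇐ the SHARPEST RESIDUE**: to prove that every helicity-free profile of the Type-I class is not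
backward-singular at the apex, it suffices to treat those for which none of the 19 settled strata listed in the
module docstring occurs (each given to the residue prover as a negated existential). -/
theorem frobeniusProfileRigidity_of_sharpest
    (hres : ∀ (C : ℝ) (v : ℝ → EuclideanSpace ℝ (Fin 3) → EuclideanSpace ℝ (Fin 3)),
      Literature.Analysis.FluidPDE.HasTypeITimeDecay C v →
      ContinuousOn (Function.uncurry v) (Set.Iio (0 : ℝ) ×ˢ Set.univ) →
      (∀ s t : ℝ, s < t → t < 0 → ∀ x, v t x =
        Literature.Analysis.UnboundedOperators.heatExtension (v s) (t - s) x -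
          Literature.Analysis.FluidPDE.oseenDuhamel 1 s v v t x) →
      (∀ t < 0, Literature.Analysis.FluidPDE.VectorCalculus.IsDivFree (v t)) →
      (∀ s < 0, ∀ y : EuclideanSpace ℝ (Fin 3), ⟪v s y, Literature.Analysis.FluidPDE.curl (v s) y⟫_ℝ = 0) →
      -- (1) no aligned slice (R7)
      (¬ (∃ s < 0, ∃ b : EuclideanSpace ℝ (Fin 3), b ≠ 0 ∧ ∀ y, Literature.Analysis.FluidPDE.cross (Literature.Analysis.FluidPDE.curl (v s) y) b = 0)) →
      -- (2) no translation-invariant slice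
      (¬ (∃ s < 0, ∃ e : EuclideanSpace ℝ (Fin 3), e ≠ 0 ∧ ∀ (y : EuclideanSpace ℝ (Fin 3)) (l : ℝ), v s (y + l • e) = v s y)) →
      -- (3) no axisymmetric without swirl about some axis, one slice
      (¬ (∃ s < 0, ∃ (L : EuclideanSpace ℝ (Fin 3) ≃ₗᵢ[ℝ] EuclideanSpace ℝ (Fin 3)) (c : EuclideanSpace ℝ (Fin 3)), Literature.Analysis.FluidPDE.IsAxisymmetric (fun y => L.symm (v s (L y + c))) ∧ Literature.Analysis.FluidPDE.HasNoSwirl (fun y => L.symm (v s (L y + c))))) →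
      -- (4) no backward self-similar about some centre
      (¬ (∃ c : EuclideanSpace ℝ (Fin 3), ∀ lam : ℝ, 0 < lam → ∀ s < 0, ∀ y, lam • v (lam ^ 2 * s) (c + lam • (y - c)) = v s y)) →
      -- (5) no time-periodic
      (¬ (∃ P : ℝ, 0 < P ∧ ∀ s < 0, ∀ y, v (s - P) y = v s y)) →
      -- (6) no one velocity component identically zero (S10's strict shadow)
      (¬ (∃ e : EuclideanSpace ℝ (Fin 3), e ≠ 0 ∧ ∀ s < 0, ∀ y, ⟪v s y, e⟫_ℝ = 0)) →
      -- (7) no GERM: vorticity aligned on a window of one slice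
      (¬ (∃ s < 0, ∃ U : Set (EuclideanSpace ℝ (Fin 3)), IsOpen U ∧ U.Nonempty ∧ ∃ b : EuclideanSpace ℝ (Fin 3), b ≠ 0 ∧ ∀ y ∈ U, Literature.Analysis.FluidPDE.cross (Literature.Analysis.FluidPDE.curl (v s) y) b = 0)) →
      -- (8) no GERM: one directional derivative vanishing on a window of one slice (S13's one-slice crux)
      (¬ (∃ s < 0, ∃ U : Set (EuclideanSpace ℝ (Fin 3)), IsOpen U ∧ U.Nonempty ∧ ∃ e : EuclideanSpace ℝ (Fin 3), e ≠ 0 ∧ ∀ y ∈ U, fderiv ℝ (v s) y e = 0)) →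
      -- (9) no GERM: infinitesimally axisymmetric and swirl-free in some rigid frame on a window of one slice
      (¬ (∃ s < 0, ∃ U : Set (EuclideanSpace ℝ (Fin 3)), IsOpen U ∧ U.Nonempty ∧ ∃ (L : EuclideanSpace ℝ (Fin 3) ≃ₗᵢ[ℝ] EuclideanSpace ℝ (Fin 3)) (c : EuclideanSpace ℝ (Fin 3)), ∀ y ∈ U, fderiv ℝ (fun y => L.symm (v s (L y + c))) y (Literature.Analysis.FluidPDE.rotGen y) = Literature.Analysis.FluidPDE.rotGen (L.symm (v s (L y + c))) ∧ Literature.Analysis.FluidPDE.swirl (fun y => L.symm (v s (L y + c))) y = 0)) →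
      -- (10) no GERM: AFFINE vorticity on a window of one slice (screw fields included)
      (¬ (∃ s < 0, ∃ U : Set (EuclideanSpace ℝ (Fin 3)), IsOpen U ∧ U.Nonempty ∧ ∃ (A : EuclideanSpace ℝ (Fin 3) →L[ℝ] EuclideanSpace ℝ (Fin 3)) (b : EuclideanSpace ℝ (Fin 3)), ∀ y ∈ U, Literature.Analysis.FluidPDE.curl (v s) y = A y + b)) →
      -- (11) no spatially periodic slice
      (¬ (∃ s < 0, ∃ ℓ : EuclideanSpace ℝ (Fin 3), ℓ ≠ 0 ∧ ∀ y, v s (y + ℓ) = v s y)) →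
      -- (12) no helically symmetric slice about some axis, pitch ≠ 0 (swirl allowed)
      (¬ (∃ s < 0, ∃ (L : EuclideanSpace ℝ (Fin 3) ≃ₗᵢ[ℝ] EuclideanSpace ℝ (Fin 3)) (c : EuclideanSpace ℝ (Fin 3)) (h : ℝ), h ≠ 0 ∧ ∀ (θ : ℝ) (y : EuclideanSpace ℝ (Fin 3)), L.symm (v s (L (Literature.Analysis.FluidPDE.rotZ θ y + (h * θ) • Literature.Analysis.FluidPDE.eZ) + c)) = Literature.Analysis.FluidPDE.rotZ θ (L.symm (v s (L y + c))))) →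
      -- (13) no (−1)-homogeneous slice about some centre
      (¬ (∃ s < 0, ∃ c : EuclideanSpace ℝ (Fin 3), ∀ lam : ℝ, 0 < lam → ∀ w : EuclideanSpace ℝ (Fin 3), v s (c + lam • w) = lam⁻¹ • v s (c + w))) →
      -- (14) no slice equivariant under a finite-order rigid screw (rational discrete screw, glide)
      (¬ (∃ s < 0, ∃ (L : EuclideanSpace ℝ (Fin 3) ≃ₗᵢ[ℝ] EuclideanSpace ℝ (Fin 3)) (ℓ : EuclideanSpace ℝ (Fin 3)), ℓ ≠ 0 ∧ L ℓ = ℓ ∧ ∃ n : ℕ, 0 < n ∧ (∀ z, (⇑L)^[n] z = z) ∧ ∀ y, v s (L y + ℓ) = L (v s y))) →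
      -- (15) no VORTICITY translation-invariant along a line on one slice (stratum (A))
      (¬ (∃ s < 0, ∃ e : EuclideanSpace ℝ (Fin 3), e ≠ 0 ∧ ∀ (y : EuclideanSpace ℝ (Fin 3)) (l : ℝ), Literature.Analysis.FluidPDE.curl (v s) (y + l • e) = Literature.Analysis.FluidPDE.curl (v s) y)) →
      -- (16) no HARMONIC vorticity on one slice (stratum (B))
      (¬ (∃ s < 0, ∀ y, (Δ (Literature.Analysis.FluidPDE.curl (v s))) y = 0)) →
      -- (17) no time-periodic VORTICITY
      (¬ (∃ P : ℝ, 0 < P ∧ ∀ s < 0, ∀ y, Literature.Analysis.FluidPDE.curl (v (s - P)) y = Literature.Analysis.FluidPDE.curl (v s) y)) →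
      -- (18) no relative periodic modulo a rigid motion
      (¬ (∃ P : ℝ, 0 < P ∧ ∃ (g : EuclideanSpace ℝ (Fin 3) → EuclideanSpace ℝ (Fin 3)) (L : EuclideanSpace ℝ (Fin 3) ≃ₗᵢ[ℝ] EuclideanSpace ℝ (Fin 3)), ∀ s < 0, ∀ y, v (s - P) (g y) = L (v s y))) →
      -- (19) no scale-invariant size tending to zero in the far past (zoom-out, M9)
      (¬ (∀ ε : ℝ, 0 < ε → ∃ T : ℝ, T < 0 ∧ ∀ t < T, ∀ x, Real.sqrt (-t) * ‖v t x‖ ≤ ε)) →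
      ¬ Literature.Analysis.FluidPDE.IsBackwardSingularPoint v 0) :
    ∀ (C : ℝ) (v : ℝ → EuclideanSpace ℝ (Fin 3) → EuclideanSpace ℝ (Fin 3)),
      Literature.Analysis.FluidPDE.HasTypeITimeDecay C v →
      ContinuousOn (Function.uncurry v) (Set.Iio (0 : ℝ) ×ˢ Set.univ) →
      (∀ s t : ℝ, s < t → t < 0 → ∀ x, v t x =
        Literature.Analysis.UnboundedOperators.heatExtension (v s) (t - s) x -
          Literature.Analysis.FluidPDE.oseenDuhamel 1 s v v t x) →
      (∀ t < 0, Literature.Analysis.FluidPDE.VectorCalculus.IsDivFree (v t)) →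
      (∀ s < 0, ∀ y : EuclideanSpace ℝ (Fin 3), ⟪v s y, Literature.Analysis.FluidPDE.curl (v s) y⟫_ℝ = 0) →
      ¬ Literature.Analysis.FluidPDE.IsBackwardSingularPoint v 0 := by
  intro C v hrate hcont hmild hdiv hhel
  -- (1) aligned slice (R7)
  by_cases h1 : ∃ s < 0, ∃ b : EuclideanSpace ℝ (Fin 3), b ≠ 0 ∧ ∀ y, Literature.Analysis.FluidPDE.cross (Literature.Analysis.FluidPDE.curl (v s) y) b = 0
  · obtain ⟨s, hs, b, hb, hal⟩ := h1
    exact not_backwardSingular_of_zero (eq_zero_of_aligned hrate hcont hmild hdiv hb hs hal)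
  -- (2) translation-invariant slice
  by_cases h2 : ∃ s < 0, ∃ e : EuclideanSpace ℝ (Fin 3), e ≠ 0 ∧ ∀ (y : EuclideanSpace ℝ (Fin 3)) (l : ℝ), v s (y + l • e) = v s y
  · obtain ⟨s, hs, e, he, htr⟩ := h2
    exact nonflatLiouville_of_translate_eq_slice hrate hcont hmild hdiv hs he htr
  -- (3) axisymmetric without swirl about some axis, one slice
  by_cases h3 : ∃ s < 0, ∃ (L : EuclideanSpace ℝ (Fin 3) ≃ₗᵢ[ℝ] EuclideanSpace ℝ (Fin 3)) (c : EuclideanSpace ℝ (Fin 3)), Literature.Analysis.FluidPDE.IsAxisymmetric (fun y => L.symm (v s (L y + c))) ∧ Literature.Analysis.FluidPDE.HasNoSwirl (fun y => L.symm (v s (L y + c)))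
  · obtain ⟨s, hs, L, c, hax, hsw⟩ := h3
    exact not_backwardSingular_of_zero (eq_zero_of_axisymmetric_noSwirl_anyAxis_slice hrate hcont hmild hdiv L c hs hax hsw)
  -- (4) backward self-similar about some centre
  by_cases h4 : ∃ c : EuclideanSpace ℝ (Fin 3), ∀ lam : ℝ, 0 < lam → ∀ s < 0, ∀ y, lam • v (lam ^ 2 * s) (c + lam • (y - c)) = v s y
  · obtain ⟨c, hsc⟩ := h4
    exact nonflatLiouville_of_scaleInvariant_centre hrate hcont hmild hdiv c hsc
  -- (5) time-periodic
  by_cases h5 : ∃ P : ℝ, 0 < P ∧ ∀ s < 0, ∀ y, v (s - P) y = v s y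
  · obtain ⟨P, hP, hper⟩ := h5
    exact nonflatLiouville_of_timePeriodic hrate hP hper
  -- (6) one velocity component identically zero (S10's strict shadow)
  by_cases h6 : ∃ e : EuclideanSpace ℝ (Fin 3), e ≠ 0 ∧ ∀ s < 0, ∀ y, ⟪v s y, e⟫_ℝ = 0
  · obtain ⟨e, he, hcomp⟩ := h6
    exact not_backwardSingular_of_inner_eq_zero hrate hcont hmild hdiv he hcomp
  -- (7) GERM: vorticity aligned on a window of one slice
  by_cases h7 : ∃ s < 0, ∃ U : Set (EuclideanSpace ℝ (Fin 3)), IsOpen U ∧ U.Nonempty ∧ ∃ b : EuclideanSpace ℝ (Fin 3), b ≠ 0 ∧ ∀ y ∈ U, Literature.Analysis.FluidPDE.cross (Literature.Analysis.FluidPDE.curl (v s) y) b = 0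
  · obtain ⟨s, hs, U, hU, hne, b, hb, hal⟩ := h7
    exact not_backwardSingular_of_zero (eq_zero_of_aligned_window hrate hcont hmild hdiv hs hb hU hne hal)
  -- (8) GERM: one directional derivative vanishing on a window of one slice (S13's one-slice crux)
  by_cases h8 : ∃ s < 0, ∃ U : Set (EuclideanSpace ℝ (Fin 3)), IsOpen U ∧ U.Nonempty ∧ ∃ e : EuclideanSpace ℝ (Fin 3), e ≠ 0 ∧ ∀ y ∈ U, fderiv ℝ (v s) y e = 0
  · obtain ⟨s, hs, U, hU, hne, e, he, hdir⟩ := h8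
    exact oneSliceCrux_dirDerivNorm he C v hrate hcont hmild hdiv ⟨s, hs, U, hU, hne, fun z hz => by simpa only [norm_eq_zero] using hdir z hz⟩
  -- (9) GERM: infinitesimally axisymmetric and swirl-free in some rigid frame on a window of one slice
  by_cases h9 : ∃ s < 0, ∃ U : Set (EuclideanSpace ℝ (Fin 3)), IsOpen U ∧ U.Nonempty ∧ ∃ (L : EuclideanSpace ℝ (Fin 3) ≃ₗᵢ[ℝ] EuclideanSpace ℝ (Fin 3)) (c : EuclideanSpace ℝ (Fin 3)), ∀ y ∈ U, fderiv ℝ (fun y => L.symm (v s (L y + c))) y (Literature.Analysis.FluidPDE.rotGen y) = Literature.Analysis.FluidPDE.rotGen (L.symm (v s (L y + c))) ∧ Literature.Analysis.FluidPDE.swirl (fun y => L.symm (v s (L y + c))) y = 0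
  · obtain ⟨s, hs, U, hU, hne, L, c, hax⟩ := h9
    exact nonflatLiouville_of_axisymmetric_noSwirl_germ_anyAxis_slice hrate hcont hmild hdiv L c hs hU hne (fun y hy => (hax y hy).1) (fun y hy => (hax y hy).2)
  -- (10) GERM: AFFINE vorticity on a window of one slice (screw fields included)
  by_cases h10 : ∃ s < 0, ∃ U : Set (EuclideanSpace ℝ (Fin 3)), IsOpen U ∧ U.Nonempty ∧ ∃ (A : EuclideanSpace ℝ (Fin 3) →L[ℝ] EuclideanSpace ℝ (Fin 3)) (b : EuclideanSpace ℝ (Fin 3)), ∀ y ∈ U, Literature.Analysis.FluidPDE.curl (v s) y = A y + b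
  · obtain ⟨s, hs, U, hU, hne, A, b, haff⟩ := h10
    exact not_backwardSingular_of_zero (eq_zero_of_curl_slice_eqOn_affine hrate hcont hmild hdiv hs A b hU hne haff)
  -- (11) spatially periodic slice
  by_cases h11 : ∃ s < 0, ∃ ℓ : EuclideanSpace ℝ (Fin 3), ℓ ≠ 0 ∧ ∀ y, v s (y + ℓ) = v s y
  · obtain ⟨s, hs, ℓ, hℓ, hper⟩ := h11
    exact nonflatLiouville_of_periodic_slice hrate hcont hmild hdiv hs hℓ hper
  -- (12) helically symmetric slice about some axis, pitch ≠ 0 (swirl allowed)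
  by_cases h12 : ∃ s < 0, ∃ (L : EuclideanSpace ℝ (Fin 3) ≃ₗᵢ[ℝ] EuclideanSpace ℝ (Fin 3)) (c : EuclideanSpace ℝ (Fin 3)) (h : ℝ), h ≠ 0 ∧ ∀ (θ : ℝ) (y : EuclideanSpace ℝ (Fin 3)), L.symm (v s (L (Literature.Analysis.FluidPDE.rotZ θ y + (h * θ) • Literature.Analysis.FluidPDE.eZ) + c)) = Literature.Analysis.FluidPDE.rotZ θ (L.symm (v s (L y + c)))
  · obtain ⟨s, hs, L, c, h, hh, hhel'⟩ := h12
    exact nonflatLiouville_of_helical_slice_anyAxis hrate hcont hmild hdiv L c hs hh hhel'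
  -- (13) (−1)-homogeneous slice about some centre
  by_cases h13 : ∃ s < 0, ∃ c : EuclideanSpace ℝ (Fin 3), ∀ lam : ℝ, 0 < lam → ∀ w : EuclideanSpace ℝ (Fin 3), v s (c + lam • w) = lam⁻¹ • v s (c + w)
  · obtain ⟨s, hs, c, hhom⟩ := h13
    exact not_backwardSingular_of_zero (eq_zero_of_homogeneous_slice hrate hcont hmild hdiv hs c hhom)
  -- (14) slice equivariant under a finite-order rigid screw (rational discrete screw, glide)
  by_cases h14 : ∃ s < 0, ∃ (L : EuclideanSpace ℝ (Fin 3) ≃ₗᵢ[ℝ] EuclideanSpace ℝ (Fin 3)) (ℓ : EuclideanSpace ℝ (Fin 3)), ℓ ≠ 0 ∧ L ℓ = ℓ ∧ ∃ n : ℕ, 0 < n ∧ (∀ z, (⇑L)^[n] z = z) ∧ ∀ y, v s (L y + ℓ) = L (v s y)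
  · obtain ⟨s, hs, L, ℓ, hℓ, hfix, n, hn, hLn, hsym⟩ := h14
    exact nonflatLiouville_of_discreteScrew_slice hrate hcont hmild hdiv hs L hℓ hfix hn hLn hsym
  -- (15) VORTICITY translation-invariant along a line on one slice (stratum (A))
  by_cases h15 : ∃ s < 0, ∃ e : EuclideanSpace ℝ (Fin 3), e ≠ 0 ∧ ∀ (y : EuclideanSpace ℝ (Fin 3)) (l : ℝ), Literature.Analysis.FluidPDE.curl (v s) (y + l • e) = Literature.Analysis.FluidPDE.curl (v s) y
  · obtain ⟨s, hs, e, he, hctr⟩ := h15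
    exact nonflatLiouville_of_curl_translate_eq_slice hrate hcont hmild hdiv hs he hctr
  -- (16) HARMONIC vorticity on one slice (stratum (B))
  by_cases h16 : ∃ s < 0, ∀ y, (Δ (Literature.Analysis.FluidPDE.curl (v s))) y = 0
  · obtain ⟨s, hs, hΔ⟩ := h16
    exact nonflatLiouville_of_curl_harmonic_slice hrate hcont hmild hdiv hs hΔ
  -- (17) time-periodic VORTICITY
  by_cases h17 : ∃ P : ℝ, 0 < P ∧ ∀ s < 0, ∀ y, Literature.Analysis.FluidPDE.curl (v (s - P)) y = Literature.Analysis.FluidPDE.curl (v s) y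
  · obtain ⟨P, hP, hcper⟩ := h17
    exact nonflatLiouville_of_curl_timePeriodic hrate hcont hmild hdiv hP hcper
  -- (18) relative periodic modulo a rigid motion
  by_cases h18 : ∃ P : ℝ, 0 < P ∧ ∃ (g : EuclideanSpace ℝ (Fin 3) → EuclideanSpace ℝ (Fin 3)) (L : EuclideanSpace ℝ (Fin 3) ≃ₗᵢ[ℝ] EuclideanSpace ℝ (Fin 3)), ∀ s < 0, ∀ y, v (s - P) (g y) = L (v s y)
  · obtain ⟨P, hP, g, L, hrel⟩ := h18
    exact nonflatLiouville_of_relativePeriodic hrate hP g L hrel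
  -- (19) scale-invariant size tending to zero in the far past (zoom-out, M9)
  by_cases h19 : ∀ ε : ℝ, 0 < ε → ∃ T : ℝ, T < 0 ∧ ∀ t < T, ∀ x, Real.sqrt (-t) * ‖v t x‖ ≤ ε
  · exact not_backwardSingular_of_zero (eq_zero_of_tendsto_zero hrate hcont hmild h19)
  exact hres C v hrate hcont hmild hdiv hhel h1 h2 h3 h4 h5 h6 h7 h8 h9 h10 h11 h12 h13 h14 h15 h16 h17 h18 h19

end Summit.NavierStokesRegularity.NavierStokesRegularity.Theorems.LocalHelicityTubeDoorFrobeniusProfileRigiditySharpest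

end
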